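import Summits.ValiantsHypothesis.ValiantsHypothesis.Theorems.KPlusLogSqLawMixedGaugeTwoThirdsLoewnerKernel

/-!
# Route «KPlusLogSqLaw», `WeakLifting` (stmt-ValiantsHypothesis-19561) — THREE signed classes (+a, +2a, −3a): `ζ ≤ n₁ + n₂ + 2m`

HONEST FRAMING.  Helper file (seat val-sym-lift-p4 g26, cell `pub-symmetroid`, 2026-08-29; `--supports 19561 --as helper`, zero crux credit),
tenth of the mixed-gauge series.  Object: the signed vertex gauge with two slow POSITIVE classes (exponents `a`, `2a`; sizes `n₁`, `n₂`) and one
fast NEGATIVE class (exponent `3a`, size `m`): `N + diag(x^a·1, x^{2a}·1, −x^{3a}·1)`, `N = [[A₁,B₁₂,B₁],[B₁₂ᵀ,A₂,B₂],[B₁ᵀ,B₂ᵀ,C]]` symmetric.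
LOCATED (memo MIXED-GAUGE-LAW §4b, pattern (+,+,−)): maximum `n₁ + n₂ + 2m` («splitting the slow side is free»).  THIS FILE proves it in
kernel-vector currency (`card_posZeros_le_threeClass`; Descartes ≈ `n₁ + 2n₂ + 3m`).  Mechanism: three-block two-point identity
(`two_point_three`); UP ≤ n₁+n₂+m (`up_card_le_three`: the scalar Φ ≡ 0 on a relation expands into a `t^{2/3}`-Loewner form of the `w₁`'s,
a cube-root Loewner form of the `w₂`'s and a positive diagonal); DOWN ≤ m (`down_card_le_three`: Gram of the `q`'s = cube-root kernel on
the `w₁`'s + `t^{2/3}` kernel on the `w₂`'s + non-negative diagonal; strictness from `cubeLoewner_posDef`, `twoThirdsLoewner_posDef`).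
Nothing here is about `WeakLifting` / `TropicalB` in their windows, the doors, `MatrixDescartes` (18050) or VP ≠ VNP.  No `def`; axioms std.
-/

set_option linter.dupNamespace false
set_option autoImplicit false

namespace Summit.ValiantsHypothesis.ValiantsHypothesis.Theorems.KPlusLogSqLaw

open Matrix Finset
open scoped BigOperators

namespace MixedGauge

variable {n₁ n₂ m : ℕ}

/-! ## 1. The three-block two-point identity -/

/-- **Three-block two-point identity**: solutions of the block system at `(s₁,s₂,t)` and `(s₁',s₂',t')` satisfy
`(s₁'−s₁)⟪w₁,w₁'⟫ + (s₂'−s₂)⟪w₂,w₂'⟫ = (t'−t)⟪q,q'⟫` (`A₁, A₂, C` symmetric; `B₁₂, B₁, B₂` arbitrary). -/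
theorem two_point_three (A₁ : Matrix (Fin n₁) (Fin n₁) ℝ) (hA₁ : A₁.IsSymm) (A₂ : Matrix (Fin n₂) (Fin n₂) ℝ) (hA₂ : A₂.IsSymm)
    (C : Matrix (Fin m) (Fin m) ℝ) (hC : C.IsSymm) (B₁₂ : Matrix (Fin n₁) (Fin n₂) ℝ) (B₁ : Matrix (Fin n₁) (Fin m) ℝ)
    (B₂ : Matrix (Fin n₂) (Fin m) ℝ) (s₁ s₂ t s₁' s₂' t' : ℝ)
    (w₁ w₁' : Fin n₁ → ℝ) (w₂ w₂' : Fin n₂ → ℝ) (q q' : Fin m → ℝ)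
    (h1 : (A₁ + s₁ • (1 : Matrix (Fin n₁) (Fin n₁) ℝ)) *ᵥ w₁ + B₁₂ *ᵥ w₂ + B₁ *ᵥ q = 0)
    (h2 : B₁₂ᵀ *ᵥ w₁ + (A₂ + s₂ • (1 : Matrix (Fin n₂) (Fin n₂) ℝ)) *ᵥ w₂ + B₂ *ᵥ q = 0)
    (h3 : B₁ᵀ *ᵥ w₁ + B₂ᵀ *ᵥ w₂ + (C - t • (1 : Matrix (Fin m) (Fin m) ℝ)) *ᵥ q = 0)
    (h1' : (A₁ + s₁' • (1 : Matrix (Fin n₁) (Fin n₁) ℝ)) *ᵥ w₁' + B₁₂ *ᵥ w₂' + B₁ *ᵥ q' = 0)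
    (h2' : B₁₂ᵀ *ᵥ w₁' + (A₂ + s₂' • (1 : Matrix (Fin n₂) (Fin n₂) ℝ)) *ᵥ w₂' + B₂ *ᵥ q' = 0)
    (h3' : B₁ᵀ *ᵥ w₁' + B₂ᵀ *ᵥ w₂' + (C - t' • (1 : Matrix (Fin m) (Fin m) ℝ)) *ᵥ q' = 0) :
    (s₁' - s₁) * (w₁ ⬝ᵥ w₁') + (s₂' - s₂) * (w₂ ⬝ᵥ w₂') = (t' - t) * (q ⬝ᵥ q') := by
  have e1 : w₁' ⬝ᵥ ((A₁ + s₁ • (1 : Matrix (Fin n₁) (Fin n₁) ℝ)) *ᵥ w₁ + B₁₂ *ᵥ w₂ + B₁ *ᵥ q) = 0 := by rw [h1, dotProduct_zero]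
  have e2 : w₂' ⬝ᵥ (B₁₂ᵀ *ᵥ w₁ + (A₂ + s₂ • (1 : Matrix (Fin n₂) (Fin n₂) ℝ)) *ᵥ w₂ + B₂ *ᵥ q) = 0 := by rw [h2, dotProduct_zero]
  have e3 : q' ⬝ᵥ (B₁ᵀ *ᵥ w₁ + B₂ᵀ *ᵥ w₂ + (C - t • (1 : Matrix (Fin m) (Fin m) ℝ)) *ᵥ q) = 0 := by rw [h3, dotProduct_zero]
  have e1' : w₁ ⬝ᵥ ((A₁ + s₁' • (1 : Matrix (Fin n₁) (Fin n₁) ℝ)) *ᵥ w₁' + B₁₂ *ᵥ w₂' + B₁ *ᵥ q') = 0 := by rw [h1', dotProduct_zero]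
  have e2' : w₂ ⬝ᵥ (B₁₂ᵀ *ᵥ w₁' + (A₂ + s₂' • (1 : Matrix (Fin n₂) (Fin n₂) ℝ)) *ᵥ w₂' + B₂ *ᵥ q') = 0 := by rw [h2', dotProduct_zero]
  have e3' : q ⬝ᵥ (B₁ᵀ *ᵥ w₁' + B₂ᵀ *ᵥ w₂' + (C - t' • (1 : Matrix (Fin m) (Fin m) ℝ)) *ᵥ q') = 0 := by rw [h3', dotProduct_zero]
  -- symmetric letters
  have hA₁s : w₁' ⬝ᵥ (A₁ *ᵥ w₁) = w₁ ⬝ᵥ (A₁ *ᵥ w₁') := by rw [dotProduct_mulVec, ← Matrix.mulVec_transpose, hA₁.eq, dotProduct_comm]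
  have hA₂s : w₂' ⬝ᵥ (A₂ *ᵥ w₂) = w₂ ⬝ᵥ (A₂ *ᵥ w₂') := by rw [dotProduct_mulVec, ← Matrix.mulVec_transpose, hA₂.eq, dotProduct_comm]
  have hCs : q' ⬝ᵥ (C *ᵥ q) = q ⬝ᵥ (C *ᵥ q') := by rw [dotProduct_mulVec, ← Matrix.mulVec_transpose, hC.eq, dotProduct_comm]
  -- transposed couplings
  have hB₁₂a : w₂' ⬝ᵥ (B₁₂ᵀ *ᵥ w₁) = w₁ ⬝ᵥ (B₁₂ *ᵥ w₂') := by rw [Matrix.mulVec_transpose, dotProduct_comm, ← dotProduct_mulVec]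
  have hB₁₂b : w₂ ⬝ᵥ (B₁₂ᵀ *ᵥ w₁') = w₁' ⬝ᵥ (B₁₂ *ᵥ w₂) := by rw [Matrix.mulVec_transpose, dotProduct_comm, ← dotProduct_mulVec]
  have hB₁a : q' ⬝ᵥ (B₁ᵀ *ᵥ w₁) = w₁ ⬝ᵥ (B₁ *ᵥ q') := by rw [Matrix.mulVec_transpose, dotProduct_comm, ← dotProduct_mulVec]
  have hB₁b : q ⬝ᵥ (B₁ᵀ *ᵥ w₁') = w₁' ⬝ᵥ (B₁ *ᵥ q) := by rw [Matrix.mulVec_transpose, dotProduct_comm, ← dotProduct_mulVec]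
  have hB₂a : q' ⬝ᵥ (B₂ᵀ *ᵥ w₂) = w₂ ⬝ᵥ (B₂ *ᵥ q') := by rw [Matrix.mulVec_transpose, dotProduct_comm, ← dotProduct_mulVec]
  have hB₂b : q ⬝ᵥ (B₂ᵀ *ᵥ w₂') = w₂' ⬝ᵥ (B₂ *ᵥ q) := by rw [Matrix.mulVec_transpose, dotProduct_comm, ← dotProduct_mulVec]
  rw [dotProduct_add, dotProduct_add, add_mulVec, dotProduct_add, Matrix.smul_mulVec, one_mulVec, dotProduct_smul] at e1 e1'
  rw [dotProduct_add, dotProduct_add, add_mulVec, dotProduct_add, Matrix.smul_mulVec, one_mulVec, dotProduct_smul] at e2 e2'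
  rw [dotProduct_add, dotProduct_add, sub_mulVec, dotProduct_sub, Matrix.smul_mulVec, one_mulVec, dotProduct_smul] at e3 e3'
  rw [hA₁s, dotProduct_comm w₁' w₁] at e1
  rw [hB₁₂a, hA₂s, dotProduct_comm w₂' w₂] at e2
  rw [hB₁a, hB₂a, hCs, dotProduct_comm q' q] at e3
  rw [hB₁₂b] at e2'
  rw [hB₁b, hB₂b] at e3'
  simp only [smul_eq_mul] at e1 e2 e3 e1' e2' e3'
  linear_combination (e1' + e2' + e3') - (e1 + e2 + e3)

/-! ## 2. Upward zeros are at most `n₁ + n₂ + m` -/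

/-- **Upward law (+a,+2a,−3a)** (`p = x^a`): `n₁+n₂+m+1` distinct upward zeros (`3pⱼ²‖qⱼ‖² < ‖w₁ⱼ‖² + 2pⱼ‖w₂ⱼ‖²`) cannot exist. -/
theorem up_card_le_three (p : Fin (n₁ + n₂ + m + 1) → ℝ) (hp : ∀ j, 0 < p j) (hinj : Function.Injective p)
    (w₁ : Fin (n₁ + n₂ + m + 1) → (Fin n₁ → ℝ)) (w₂ : Fin (n₁ + n₂ + m + 1) → (Fin n₂ → ℝ))
    (q : Fin (n₁ + n₂ + m + 1) → (Fin m → ℝ))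
    (hid : ∀ j k, j ≠ k → (p k - p j) * (w₁ j ⬝ᵥ w₁ k) + (p k ^ 2 - p j ^ 2) * (w₂ j ⬝ᵥ w₂ k) = (p k ^ 3 - p j ^ 3) * (q j ⬝ᵥ q k))
    (hup : ∀ j, 3 * p j ^ 2 * (q j ⬝ᵥ q j) < (w₁ j ⬝ᵥ w₁ j) + 2 * p j * (w₂ j ⬝ᵥ w₂ j)) : False := by
  classical
  let f : (Fin (n₁ + n₂ + m + 1) → ℝ) →ₗ[ℝ] ((Fin n₁ → ℝ) × (Fin n₂ → ℝ) × (Fin m → ℝ)) :=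
    { toFun := fun d => (∑ j, d j • w₁ j, ∑ j, d j • w₂ j, ∑ j, d j • q j)
      map_add' := fun d d' => by simp only [Pi.add_apply, add_smul, Finset.sum_add_distrib, Prod.mk_add_mk]
      map_smul' := fun r d => by
        simp only [Pi.smul_apply, smul_eq_mul, mul_smul, ← Finset.smul_sum, RingHom.id_apply, Prod.smul_mk] }
  have hker : LinearMap.ker f ≠ ⊥ := by
    apply LinearMap.ker_ne_bot_of_finrank_lt
    rw [Module.finrank_prod, Module.finrank_prod, Module.finrank_fin_fun, Module.finrank_fin_fun, Module.finrank_fin_fun,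
      Module.finrank_fin_fun]
    omega
  obtain ⟨d, hdker, hd0⟩ := (Submodule.ne_bot_iff _).mp hker
  have hfd : f d = 0 := LinearMap.mem_ker.mp hdker
  have hsum1 : ∑ j, d j • w₁ j = 0 := (Prod.mk_eq_zero.mp hfd).1
  have hsum2 : ∑ j, d j • w₂ j = 0 := (Prod.mk_eq_zero.mp (Prod.mk_eq_zero.mp hfd).2).1
  have hsumq : ∑ j, d j • q j = 0 := (Prod.mk_eq_zero.mp (Prod.mk_eq_zero.mp hfd).2).2
  have hKpos : ∀ j k, 0 < p j ^ 2 + p j * p k + p k ^ 2 := fun j k => by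
    have := hp j; have := hp k; positivity
  -- off-diagonal Gram relation: ⟪qⱼ,qₖ⟫·(pⱼ² + pⱼpₖ + pₖ²) = ⟪w₁ⱼ,w₁ₖ⟫ + (pⱼ + pₖ)⟪w₂ⱼ,w₂ₖ⟫
  have hG : ∀ j k, j ≠ k → (q j ⬝ᵥ q k) * (p j ^ 2 + p j * p k + p k ^ 2) = (w₁ j ⬝ᵥ w₁ k) + (p j + p k) * (w₂ j ⬝ᵥ w₂ k) := by
    intro j k hjk
    have hne : p k - p j ≠ 0 := sub_ne_zero.mpr (fun h => hjk (hinj h).symm)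
    have h := hid j k hjk
    have h' : (p k - p j) * ((q j ⬝ᵥ q k) * (p j ^ 2 + p j * p k + p k ^ 2)) =
        (p k - p j) * ((w₁ j ⬝ᵥ w₁ k) + (p j + p k) * (w₂ j ⬝ᵥ w₂ k)) := by
      have e1 : (p k - p j) * ((q j ⬝ᵥ q k) * (p j ^ 2 + p j * p k + p k ^ 2)) = (p k ^ 3 - p j ^ 3) * (q j ⬝ᵥ q k) := by ring
      have e2 : (p k - p j) * ((w₁ j ⬝ᵥ w₁ k) + (p j + p k) * (w₂ j ⬝ᵥ w₂ k)) =
          (p k - p j) * (w₁ j ⬝ᵥ w₁ k) + (p k ^ 2 - p j ^ 2) * (w₂ j ⬝ᵥ w₂ k) := by ring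
      rw [e1, e2, h]
    exact mul_left_cancel₀ hne h'
  -- Φ ≡ 0 on the relation
  have hPhi0 : ∑ j, ∑ k, d j * d k * (p k * (w₁ j ⬝ᵥ w₁ k) + p k ^ 2 * (w₂ j ⬝ᵥ w₂ k) - p k ^ 3 * (q j ⬝ᵥ q k)) = 0 := by
    have hsplit : ∀ j k, d j * d k * (p k * (w₁ j ⬝ᵥ w₁ k) + p k ^ 2 * (w₂ j ⬝ᵥ w₂ k) - p k ^ 3 * (q j ⬝ᵥ q k)) =
        (d k * p k) * ((d j • w₁ j) ⬝ᵥ w₁ k) + (d k * p k ^ 2) * ((d j • w₂ j) ⬝ᵥ w₂ k)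
          - (d k * p k ^ 3) * ((d j • q j) ⬝ᵥ q k) := by
      intro j k
      rw [smul_dotProduct, smul_dotProduct, smul_dotProduct, smul_eq_mul, smul_eq_mul, smul_eq_mul]
      ring
    simp_rw [hsplit, Finset.sum_sub_distrib, Finset.sum_add_distrib]
    rw [Finset.sum_comm (f := fun j k => (d k * p k) * ((d j • w₁ j) ⬝ᵥ w₁ k)),
      Finset.sum_comm (f := fun j k => (d k * p k ^ 2) * ((d j • w₂ j) ⬝ᵥ w₂ k)),
      Finset.sum_comm (f := fun j k => (d k * p k ^ 3) * ((d j • q j) ⬝ᵥ q k))]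
    simp_rw [← Finset.mul_sum, ← sum_dotProduct, hsum1, hsum2, hsumq, zero_dotProduct, mul_zero, Finset.sum_const_zero]
    ring
  -- Φ termwise: two Loewner forms plus a positive diagonal
  have hterm : ∀ j k, d j * d k * (p k * (w₁ j ⬝ᵥ w₁ k) + p k ^ 2 * (w₂ j ⬝ᵥ w₂ k) - p k ^ 3 * (q j ⬝ᵥ q k)) =
      (∑ i, ((d j * p j) * w₁ j i) * ((d k * p k) * w₁ k i) * (p j + p k) / (p j ^ 2 + p j * p k + p k ^ 2))
        + (∑ i, ((d j * p j ^ 2) * w₂ j i) * ((d k * p k ^ 2) * w₂ k i) / (p j ^ 2 + p j * p k + p k ^ 2))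
        + (if j = k then d j ^ 2 * ((1 / 3) * (p j * (w₁ j ⬝ᵥ w₁ j) + 2 * p j ^ 2 * (w₂ j ⬝ᵥ w₂ j)
            - 3 * p j ^ 3 * (q j ⬝ᵥ q j))) else 0) := by
    intro j k
    have hK := hKpos j k
    have hs1 : ∑ i, ((d j * p j) * w₁ j i) * ((d k * p k) * w₁ k i) * (p j + p k) / (p j ^ 2 + p j * p k + p k ^ 2) =
        (d j * p j) * (d k * p k) * (p j + p k) * (w₁ j ⬝ᵥ w₁ k) / (p j ^ 2 + p j * p k + p k ^ 2) := by
      rw [dotProduct, Finset.mul_sum, Finset.sum_div]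
      exact Finset.sum_congr rfl fun i _ => by ring
    have hs2 : ∑ i, ((d j * p j ^ 2) * w₂ j i) * ((d k * p k ^ 2) * w₂ k i) / (p j ^ 2 + p j * p k + p k ^ 2) =
        (d j * p j ^ 2) * (d k * p k ^ 2) * (w₂ j ⬝ᵥ w₂ k) / (p j ^ 2 + p j * p k + p k ^ 2) := by
      rw [dotProduct, Finset.mul_sum, Finset.sum_div]
      exact Finset.sum_congr rfl fun i _ => by ring
    rw [hs1, hs2]
    by_cases hjk : j = k
    · subst hjk
      rw [if_pos rfl]
      have hpj : p j ≠ 0 := ne_of_gt (hp j)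
      field_simp
      ring
    · rw [if_neg hjk, add_zero]
      have hg := hG j k hjk
      have hK' : p j ^ 2 + p j * p k + p k ^ 2 ≠ 0 := ne_of_gt hK
      rw [← add_div, eq_div_iff hK']
      have : d j * d k * (p k * (w₁ j ⬝ᵥ w₁ k) + p k ^ 2 * (w₂ j ⬝ᵥ w₂ k) - p k ^ 3 * (q j ⬝ᵥ q k)) *
          (p j ^ 2 + p j * p k + p k ^ 2) =
          d j * d k * (p k * (w₁ j ⬝ᵥ w₁ k) * (p j ^ 2 + p j * p k + p k ^ 2)
            + p k ^ 2 * (w₂ j ⬝ᵥ w₂ k) * (p j ^ 2 + p j * p k + p k ^ 2)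
            - p k ^ 3 * ((q j ⬝ᵥ q k) * (p j ^ 2 + p j * p k + p k ^ 2))) := by ring
      rw [this, hg]
      ring
  have hdouble : ∑ j, ∑ k, d j * d k * (p k * (w₁ j ⬝ᵥ w₁ k) + p k ^ 2 * (w₂ j ⬝ᵥ w₂ k) - p k ^ 3 * (q j ⬝ᵥ q k)) =
      (∑ j, ∑ k, ∑ i, ((d j * p j) * w₁ j i) * ((d k * p k) * w₁ k i) * (p j + p k) / (p j ^ 2 + p j * p k + p k ^ 2))
      + (∑ j, ∑ k, ∑ i, ((d j * p j ^ 2) * w₂ j i) * ((d k * p k ^ 2) * w₂ k i) / (p j ^ 2 + p j * p k + p k ^ 2))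
      + ∑ j, d j ^ 2 * ((1 / 3) * (p j * (w₁ j ⬝ᵥ w₁ j) + 2 * p j ^ 2 * (w₂ j ⬝ᵥ w₂ j) - 3 * p j ^ 3 * (q j ⬝ᵥ q j))) := by
    simp_rw [hterm, Finset.sum_add_distrib, Finset.sum_ite_eq, Finset.mem_univ, if_true]
  have hH1 : 0 ≤ ∑ j, ∑ k, ∑ i, ((d j * p j) * w₁ j i) * ((d k * p k) * w₁ k i) * (p j + p k) / (p j ^ 2 + p j * p k + p k ^ 2) := by
    have hc : (∑ j, ∑ k, ∑ i, ((d j * p j) * w₁ j i) * ((d k * p k) * w₁ k i) * (p j + p k) / (p j ^ 2 + p j * p k + p k ^ 2)) =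
        ∑ i, ∑ j, ∑ k, ((d j * p j) * w₁ j i) * ((d k * p k) * w₁ k i) * (p j + p k) / (p j ^ 2 + p j * p k + p k ^ 2) := by
      calc _ = ∑ j, ∑ i, ∑ k, ((d j * p j) * w₁ j i) * ((d k * p k) * w₁ k i) * (p j + p k) / (p j ^ 2 + p j * p k + p k ^ 2) :=
            Finset.sum_congr rfl fun j _ => Finset.sum_comm
        _ = _ := Finset.sum_comm
    rw [hc]
    exact Finset.sum_nonneg fun i _ => twoThirdsLoewner_nonneg p (fun j => (d j * p j) * w₁ j i) hp
  have hH2 : 0 ≤ ∑ j, ∑ k, ∑ i, ((d j * p j ^ 2) * w₂ j i) * ((d k * p k ^ 2) * w₂ k i) / (p j ^ 2 + p j * p k + p k ^ 2) := by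
    have hc : (∑ j, ∑ k, ∑ i, ((d j * p j ^ 2) * w₂ j i) * ((d k * p k ^ 2) * w₂ k i) / (p j ^ 2 + p j * p k + p k ^ 2)) =
        ∑ i, ∑ j, ∑ k, ((d j * p j ^ 2) * w₂ j i) * ((d k * p k ^ 2) * w₂ k i) / (p j ^ 2 + p j * p k + p k ^ 2) := by
      calc _ = ∑ j, ∑ i, ∑ k, ((d j * p j ^ 2) * w₂ j i) * ((d k * p k ^ 2) * w₂ k i) / (p j ^ 2 + p j * p k + p k ^ 2) :=
            Finset.sum_congr rfl fun j _ => Finset.sum_comm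
        _ = _ := Finset.sum_comm
    rw [hc]
    exact Finset.sum_nonneg fun i _ => cubeLoewner_nonneg p (fun j => (d j * p j ^ 2) * w₂ j i) hp
  have hdiag : 0 < ∑ j, d j ^ 2 * ((1 / 3) * (p j * (w₁ j ⬝ᵥ w₁ j) + 2 * p j ^ 2 * (w₂ j ⬝ᵥ w₂ j)
      - 3 * p j ^ 3 * (q j ⬝ᵥ q j))) := by
    obtain ⟨j0, hj0⟩ : ∃ j, d j ≠ 0 := by
      by_contra h; push Not at h; exact hd0 (funext h)
    have hpos : ∀ j, 0 < (1 / 3) * (p j * (w₁ j ⬝ᵥ w₁ j) + 2 * p j ^ 2 * (w₂ j ⬝ᵥ w₂ j) - 3 * p j ^ 3 * (q j ⬝ᵥ q j)) := by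
      intro j
      have h := hup j
      have hpj := hp j
      have : 0 < p j * ((w₁ j ⬝ᵥ w₁ j) + 2 * p j * (w₂ j ⬝ᵥ w₂ j) - 3 * p j ^ 2 * (q j ⬝ᵥ q j)) := mul_pos hpj (by linarith)
      nlinarith
    apply Finset.sum_pos'
    · intro j _
      exact mul_nonneg (sq_nonneg _) (le_of_lt (hpos j))
    · exact ⟨j0, Finset.mem_univ _, mul_pos (by positivity) (hpos j0)⟩
  rw [hdouble] at hPhi0
  linarith

/-! ## 3. Downward zeros are at most `m` -/

/-- **Downward law (+a,+2a,−3a)**: `m+1` distinct downward zeros (`‖w₁ⱼ‖² + 2pⱼ‖w₂ⱼ‖² ≤ 3pⱼ²‖qⱼ‖²`, non-zero data) cannot exist. -/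
theorem down_card_le_three (p : Fin (m + 1) → ℝ) (hp : ∀ j, 0 < p j) (hinj : Function.Injective p)
    (w₁ : Fin (m + 1) → (Fin n₁ → ℝ)) (w₂ : Fin (m + 1) → (Fin n₂ → ℝ)) (q : Fin (m + 1) → (Fin m → ℝ))
    (hnz : ∀ j, w₁ j ≠ 0 ∨ w₂ j ≠ 0 ∨ q j ≠ 0)
    (hid : ∀ j k, j ≠ k → (p k - p j) * (w₁ j ⬝ᵥ w₁ k) + (p k ^ 2 - p j ^ 2) * (w₂ j ⬝ᵥ w₂ k) = (p k ^ 3 - p j ^ 3) * (q j ⬝ᵥ q k))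
    (hdown : ∀ j, (w₁ j ⬝ᵥ w₁ j) + 2 * p j * (w₂ j ⬝ᵥ w₂ j) ≤ 3 * p j ^ 2 * (q j ⬝ᵥ q j)) : False := by
  classical
  let f : (Fin (m + 1) → ℝ) →ₗ[ℝ] (Fin m → ℝ) :=
    { toFun := fun d => ∑ j, d j • q j
      map_add' := fun d d' => by simp only [Pi.add_apply, add_smul, Finset.sum_add_distrib]
      map_smul' := fun r d => by simp only [Pi.smul_apply, smul_eq_mul, mul_smul, ← Finset.smul_sum, RingHom.id_apply] }
  have hker : LinearMap.ker f ≠ ⊥ := by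
    apply LinearMap.ker_ne_bot_of_finrank_lt
    rw [Module.finrank_fin_fun, Module.finrank_fin_fun]
    omega
  obtain ⟨c, hcker, hc0⟩ := (Submodule.ne_bot_iff _).mp hker
  have hsumq : ∑ j, c j • q j = 0 := LinearMap.mem_ker.mp hcker
  have hKpos : ∀ j k, 0 < p j ^ 2 + p j * p k + p k ^ 2 := fun j k => by
    have := hp j; have := hp k; positivity
  have hG : ∀ j k, j ≠ k → q j ⬝ᵥ q k = ((w₁ j ⬝ᵥ w₁ k) + (p j + p k) * (w₂ j ⬝ᵥ w₂ k)) / (p j ^ 2 + p j * p k + p k ^ 2) := by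
    intro j k hjk
    have hne : p k - p j ≠ 0 := sub_ne_zero.mpr (fun h => hjk (hinj h).symm)
    have h := hid j k hjk
    have h' : (p k - p j) * ((q j ⬝ᵥ q k) * (p j ^ 2 + p j * p k + p k ^ 2)) =
        (p k - p j) * ((w₁ j ⬝ᵥ w₁ k) + (p j + p k) * (w₂ j ⬝ᵥ w₂ k)) := by
      have e1 : (p k - p j) * ((q j ⬝ᵥ q k) * (p j ^ 2 + p j * p k + p k ^ 2)) = (p k ^ 3 - p j ^ 3) * (q j ⬝ᵥ q k) := by ring
      have e2 : (p k - p j) * ((w₁ j ⬝ᵥ w₁ k) + (p j + p k) * (w₂ j ⬝ᵥ w₂ k)) =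
          (p k - p j) * (w₁ j ⬝ᵥ w₁ k) + (p k ^ 2 - p j ^ 2) * (w₂ j ⬝ᵥ w₂ k) := by ring
      rw [e1, e2, h]
    have h'' := mul_left_cancel₀ hne h'
    rw [eq_div_iff (ne_of_gt (hKpos j k)), h'']
  have hzero : (∑ j, c j • q j) ⬝ᵥ (∑ k, c k • q k) = 0 := by rw [hsumq, dotProduct_zero]
  have hexp : (∑ j, c j • q j) ⬝ᵥ (∑ k, c k • q k) = ∑ j, ∑ k, c j * c k * (q j ⬝ᵥ q k) := by
    rw [sum_dotProduct]
    refine Finset.sum_congr rfl fun j _ => ?_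
    rw [dotProduct_sum]
    refine Finset.sum_congr rfl fun k _ => ?_
    rw [smul_dotProduct, dotProduct_smul, smul_eq_mul, smul_eq_mul]
    ring
  have hterm : ∀ j k, c j * c k * (q j ⬝ᵥ q k) =
      (∑ i, (c j * w₁ j i) * (c k * w₁ k i) / (p j ^ 2 + p j * p k + p k ^ 2))
        + (∑ i, (c j * w₂ j i) * (c k * w₂ k i) * (p j + p k) / (p j ^ 2 + p j * p k + p k ^ 2))
        + (if j = k then c j ^ 2 * (q j ⬝ᵥ q j - ((w₁ j ⬝ᵥ w₁ j) + 2 * p j * (w₂ j ⬝ᵥ w₂ j)) / (3 * p j ^ 2)) else 0) := by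
    intro j k
    have hs1 : ∑ i, (c j * w₁ j i) * (c k * w₁ k i) / (p j ^ 2 + p j * p k + p k ^ 2) =
        c j * c k * (w₁ j ⬝ᵥ w₁ k) / (p j ^ 2 + p j * p k + p k ^ 2) := by
      rw [dotProduct, Finset.mul_sum, Finset.sum_div]
      exact Finset.sum_congr rfl fun i _ => by ring
    have hs2 : ∑ i, (c j * w₂ j i) * (c k * w₂ k i) * (p j + p k) / (p j ^ 2 + p j * p k + p k ^ 2) =
        c j * c k * ((p j + p k) * (w₂ j ⬝ᵥ w₂ k)) / (p j ^ 2 + p j * p k + p k ^ 2) := by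
      rw [dotProduct, Finset.mul_sum, Finset.mul_sum, Finset.sum_div]
      exact Finset.sum_congr rfl fun i _ => by ring
    rw [hs1, hs2]
    by_cases hjk : j = k
    · subst hjk
      rw [if_pos rfl]
      have hpj : p j ≠ 0 := ne_of_gt (hp j)
      field_simp
      ring
    · rw [if_neg hjk, add_zero, hG j k hjk]
      ring
  have hdouble : ∑ j, ∑ k, c j * c k * (q j ⬝ᵥ q k) =
      (∑ j, ∑ k, ∑ i, (c j * w₁ j i) * (c k * w₁ k i) / (p j ^ 2 + p j * p k + p k ^ 2))
      + (∑ j, ∑ k, ∑ i, (c j * w₂ j i) * (c k * w₂ k i) * (p j + p k) / (p j ^ 2 + p j * p k + p k ^ 2))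
      + ∑ j, c j ^ 2 * (q j ⬝ᵥ q j - ((w₁ j ⬝ᵥ w₁ j) + 2 * p j * (w₂ j ⬝ᵥ w₂ j)) / (3 * p j ^ 2)) := by
    simp_rw [hterm, Finset.sum_add_distrib, Finset.sum_ite_eq, Finset.mem_univ, if_true]
  -- the three blocks are non-negative
  have hc1 : (∑ j, ∑ k, ∑ i, (c j * w₁ j i) * (c k * w₁ k i) / (p j ^ 2 + p j * p k + p k ^ 2)) =
      ∑ i, ∑ j, ∑ k, (c j * w₁ j i) * (c k * w₁ k i) / (p j ^ 2 + p j * p k + p k ^ 2) := by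
    calc _ = ∑ j, ∑ i, ∑ k, (c j * w₁ j i) * (c k * w₁ k i) / (p j ^ 2 + p j * p k + p k ^ 2) :=
          Finset.sum_congr rfl fun j _ => Finset.sum_comm
      _ = _ := Finset.sum_comm
  have hc2 : (∑ j, ∑ k, ∑ i, (c j * w₂ j i) * (c k * w₂ k i) * (p j + p k) / (p j ^ 2 + p j * p k + p k ^ 2)) =
      ∑ i, ∑ j, ∑ k, (c j * w₂ j i) * (c k * w₂ k i) * (p j + p k) / (p j ^ 2 + p j * p k + p k ^ 2) := by
    calc _ = ∑ j, ∑ i, ∑ k, (c j * w₂ j i) * (c k * w₂ k i) * (p j + p k) / (p j ^ 2 + p j * p k + p k ^ 2) :=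
          Finset.sum_congr rfl fun j _ => Finset.sum_comm
      _ = _ := Finset.sum_comm
  have hK1i : ∀ i, 0 ≤ ∑ j, ∑ k, (c j * w₁ j i) * (c k * w₁ k i) / (p j ^ 2 + p j * p k + p k ^ 2) :=
    fun i => cubeLoewner_nonneg p (fun j => c j * w₁ j i) hp
  have hK2i : ∀ i, 0 ≤ ∑ j, ∑ k, (c j * w₂ j i) * (c k * w₂ k i) * (p j + p k) / (p j ^ 2 + p j * p k + p k ^ 2) :=
    fun i => twoThirdsLoewner_nonneg p (fun j => c j * w₂ j i) hp
  have hA1 : 0 ≤ ∑ j, ∑ k, ∑ i, (c j * w₁ j i) * (c k * w₁ k i) / (p j ^ 2 + p j * p k + p k ^ 2) := by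
    rw [hc1]; exact Finset.sum_nonneg fun i _ => hK1i i
  have hA2 : 0 ≤ ∑ j, ∑ k, ∑ i, (c j * w₂ j i) * (c k * w₂ k i) * (p j + p k) / (p j ^ 2 + p j * p k + p k ^ 2) := by
    rw [hc2]; exact Finset.sum_nonneg fun i _ => hK2i i
  have hexcess : ∀ j, 0 ≤ q j ⬝ᵥ q j - ((w₁ j ⬝ᵥ w₁ j) + 2 * p j * (w₂ j ⬝ᵥ w₂ j)) / (3 * p j ^ 2) := fun j => by
    have h3 : 0 < 3 * p j ^ 2 := by have := hp j; positivity
    rw [sub_nonneg, div_le_iff₀ h3]; linarith [hdown j]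
  have hB : 0 ≤ ∑ j, c j ^ 2 * (q j ⬝ᵥ q j - ((w₁ j ⬝ᵥ w₁ j) + 2 * p j * (w₂ j ⬝ᵥ w₂ j)) / (3 * p j ^ 2)) :=
    Finset.sum_nonneg fun j _ => mul_nonneg (sq_nonneg _) (hexcess j)
  rw [hexp, hdouble] at hzero
  have hA10 : ∑ j, ∑ k, ∑ i, (c j * w₁ j i) * (c k * w₁ k i) / (p j ^ 2 + p j * p k + p k ^ 2) = 0 := by linarith
  have hA20 : ∑ j, ∑ k, ∑ i, (c j * w₂ j i) * (c k * w₂ k i) * (p j + p k) / (p j ^ 2 + p j * p k + p k ^ 2) = 0 := by linarith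
  have hB0 : ∑ j, c j ^ 2 * (q j ⬝ᵥ q j - ((w₁ j ⬝ᵥ w₁ j) + 2 * p j * (w₂ j ⬝ᵥ w₂ j)) / (3 * p j ^ 2)) = 0 := by linarith
  have hcw1 : ∀ j i, c j * w₁ j i = 0 := by
    intro j i
    rw [hc1] at hA10
    have hi0 := (Finset.sum_eq_zero_iff_of_nonneg fun i _ => hK1i i).mp hA10 i (Finset.mem_univ _)
    by_contra hne
    have hci : (fun j => c j * w₁ j i) ≠ 0 := fun h => hne (congrFun h j)
    have := cubeLoewner_posDef (m + 1) p (fun j => c j * w₁ j i) hp hinj hci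
    linarith
  have hcw2 : ∀ j i, c j * w₂ j i = 0 := by
    intro j i
    rw [hc2] at hA20
    have hi0 := (Finset.sum_eq_zero_iff_of_nonneg fun i _ => hK2i i).mp hA20 i (Finset.mem_univ _)
    by_contra hne
    have hci : (fun j => c j * w₂ j i) ≠ 0 := fun h => hne (congrFun h j)
    have := twoThirdsLoewner_posDef (m + 1) p (fun j => c j * w₂ j i) hp hinj hci
    linarith
  obtain ⟨j0, hj0⟩ : ∃ j, c j ≠ 0 := by
    by_contra h; push Not at h; exact hc0 (funext h)
  have hw10 : w₁ j0 = 0 := funext fun i => (mul_eq_zero.mp (hcw1 j0 i)).resolve_left hj0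
  have hw20 : w₂ j0 = 0 := funext fun i => (mul_eq_zero.mp (hcw2 j0 i)).resolve_left hj0
  have hB0' := (Finset.sum_eq_zero_iff_of_nonneg fun j _ => mul_nonneg (sq_nonneg _) (hexcess j)).mp hB0 j0 (Finset.mem_univ _)
  have hq0 : q j0 ⬝ᵥ q j0 = 0 := by
    have hc2' : c j0 ^ 2 ≠ 0 := pow_ne_zero 2 hj0
    have := (mul_eq_zero.mp hB0').resolve_left hc2'
    rw [hw10, hw20, zero_dotProduct, zero_dotProduct, mul_zero, add_zero, zero_div, sub_zero] at this
    exact this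
  have hq0' : q j0 = 0 := dotProduct_self_eq_zero.mp hq0
  rcases hnz j0 with h | h | h
  exacts [h hw10, h hw20, h hq0']

/-! ## 4. The count `ζ ≤ n₁ + n₂ + 2m` -/

/-- **THREE-CLASS LAW (+a, +2a, −3a): splitting the slow side is free.**  `A₁ ∈ Sym(n₁)`, `A₂ ∈ Sym(n₂)`, `C ∈ Sym(m)`, any `B₁₂, B₁, B₂`,
`1 ≤ a`: a finite set `S` of positive `x`, each admitting a non-zero solution `(w₁, w₂, q)` of
`(A₁ + x^a) w₁ + B₁₂ w₂ + B₁ q = 0`, `B₁₂ᵀ w₁ + (A₂ + x^{2a}) w₂ + B₂ q = 0`, `B₁ᵀ w₁ + B₂ᵀ w₂ + (C − x^{3a}) q = 0`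
(a kernel vector of `N + diag(x^a·1, x^{2a}·1, −x^{3a}·1)`), has `#S ≤ n₁ + n₂ + 2m`. -/
theorem card_posZeros_le_threeClass (A₁ : Matrix (Fin n₁) (Fin n₁) ℝ) (hA₁ : A₁.IsSymm) (A₂ : Matrix (Fin n₂) (Fin n₂) ℝ)
    (hA₂ : A₂.IsSymm) (C : Matrix (Fin m) (Fin m) ℝ) (hC : C.IsSymm) (B₁₂ : Matrix (Fin n₁) (Fin n₂) ℝ)
    (B₁ : Matrix (Fin n₁) (Fin m) ℝ) (B₂ : Matrix (Fin n₂) (Fin m) ℝ) (a : ℕ) (ha : 1 ≤ a) (S : Finset ℝ)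
    (hS : ∀ x ∈ S, 0 < x ∧ ∃ w₁ : Fin n₁ → ℝ, ∃ w₂ : Fin n₂ → ℝ, ∃ q : Fin m → ℝ, (w₁ ≠ 0 ∨ w₂ ≠ 0 ∨ q ≠ 0) ∧
      (A₁ + (x ^ a) • (1 : Matrix (Fin n₁) (Fin n₁) ℝ)) *ᵥ w₁ + B₁₂ *ᵥ w₂ + B₁ *ᵥ q = 0 ∧
      B₁₂ᵀ *ᵥ w₁ + (A₂ + (x ^ (2 * a)) • (1 : Matrix (Fin n₂) (Fin n₂) ℝ)) *ᵥ w₂ + B₂ *ᵥ q = 0 ∧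
      B₁ᵀ *ᵥ w₁ + B₂ᵀ *ᵥ w₂ + (C - (x ^ (3 * a)) • (1 : Matrix (Fin m) (Fin m) ℝ)) *ᵥ q = 0) :
    S.card ≤ n₁ + n₂ + 2 * m := by
  classical
  have hx : ∀ x : S, 0 < (x : ℝ) := fun x => (hS x x.2).1
  choose W₁ W₂ Q hWQ using fun x : S => (hS x x.2).2
  have hpow2 : ∀ x : ℝ, x ^ (2 * a) = (x ^ a) ^ 2 := fun x => by rw [mul_comm, pow_mul]
  have hpow3 : ∀ x : ℝ, x ^ (3 * a) = (x ^ a) ^ 3 := fun x => by rw [mul_comm, pow_mul]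
  have hsinj : ∀ x y : S, (x : ℝ) ^ a = (y : ℝ) ^ a → x = y := by
    intro x y h
    have ha0 : a ≠ 0 := by omega
    exact Subtype.ext ((pow_left_inj₀ (hx x).le (hx y).le ha0).mp h)
  have hid : ∀ x y : S, ((y : ℝ) ^ a - (x : ℝ) ^ a) * (W₁ x ⬝ᵥ W₁ y) + (((y : ℝ) ^ a) ^ 2 - ((x : ℝ) ^ a) ^ 2) * (W₂ x ⬝ᵥ W₂ y) =
      (((y : ℝ) ^ a) ^ 3 - ((x : ℝ) ^ a) ^ 3) * (Q x ⬝ᵥ Q y) := by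
    intro x y
    have h := two_point_three A₁ hA₁ A₂ hA₂ C hC B₁₂ B₁ B₂ ((x : ℝ) ^ a) ((x : ℝ) ^ (2 * a)) ((x : ℝ) ^ (3 * a))
      ((y : ℝ) ^ a) ((y : ℝ) ^ (2 * a)) ((y : ℝ) ^ (3 * a)) (W₁ x) (W₁ y) (W₂ x) (W₂ y) (Q x) (Q y)
      (hWQ x).2.1 (hWQ x).2.2.1 (hWQ x).2.2.2 (hWQ y).2.1 (hWQ y).2.2.1 (hWQ y).2.2.2
    rw [hpow2, hpow2, hpow3, hpow3] at h
    exact h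
  let down : ℝ → Prop := fun x => if hxS : x ∈ S then
    (W₁ ⟨x, hxS⟩ ⬝ᵥ W₁ ⟨x, hxS⟩) + 2 * (x ^ a) * (W₂ ⟨x, hxS⟩ ⬝ᵥ W₂ ⟨x, hxS⟩) ≤ 3 * (x ^ a) ^ 2 * (Q ⟨x, hxS⟩ ⬝ᵥ Q ⟨x, hxS⟩)
    else False
  have hsplit := Finset.card_filter_add_card_filter_not (s := S) down
  have hdown : (S.filter down).card ≤ m := by
    by_contra hlt
    push Not at hlt
    obtain ⟨T, hTsub, hTcard⟩ := Finset.exists_subset_card_eq (show m + 1 ≤ (S.filter down).card by omega)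
    have hTS : ∀ x ∈ T, x ∈ S := fun x hx => (Finset.mem_filter.mp (hTsub hx)).1
    have hTdown : ∀ x (hx : x ∈ T), (W₁ ⟨x, hTS x hx⟩ ⬝ᵥ W₁ ⟨x, hTS x hx⟩) + 2 * (x ^ a) * (W₂ ⟨x, hTS x hx⟩ ⬝ᵥ W₂ ⟨x, hTS x hx⟩)
        ≤ 3 * (x ^ a) ^ 2 * (Q ⟨x, hTS x hx⟩ ⬝ᵥ Q ⟨x, hTS x hx⟩) := by
      intro x hx
      simpa only [down, dif_pos (hTS x hx)] using (Finset.mem_filter.mp (hTsub hx)).2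
    let e : Fin (m + 1) ≃ T := (T.equivFinOfCardEq hTcard).symm
    let emb : Fin (m + 1) → S := fun j => ⟨(e j : ℝ), hTS _ (e j).2⟩
    have hembinj : Function.Injective emb := fun j k h =>
      e.injective (Subtype.ext (congrArg Subtype.val h : ((emb j : S) : ℝ) = ((emb k : S) : ℝ)))
    refine down_card_le_three (fun j => ((emb j : S) : ℝ) ^ a) (fun j => pow_pos (hx (emb j)) a) ?_
      (fun j => W₁ (emb j)) (fun j => W₂ (emb j)) (fun j => Q (emb j)) (fun j => (hWQ (emb j)).1) ?_ ?_
    · exact fun j k h => hembinj (hsinj _ _ h)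
    · exact fun j k _ => hid (emb j) (emb k)
    · exact fun j => hTdown (e j : ℝ) (e j).2
  have hupc : (S.filter fun x => ¬ down x).card ≤ n₁ + n₂ + m := by
    by_contra hlt
    push Not at hlt
    obtain ⟨T, hTsub, hTcard⟩ :=
      Finset.exists_subset_card_eq (show n₁ + n₂ + m + 1 ≤ (S.filter fun x => ¬ down x).card by omega)
    have hTS : ∀ x ∈ T, x ∈ S := fun x hx => (Finset.mem_filter.mp (hTsub hx)).1
    have hTup : ∀ x (hx : x ∈ T), 3 * (x ^ a) ^ 2 * (Q ⟨x, hTS x hx⟩ ⬝ᵥ Q ⟨x, hTS x hx⟩) <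
        (W₁ ⟨x, hTS x hx⟩ ⬝ᵥ W₁ ⟨x, hTS x hx⟩) + 2 * (x ^ a) * (W₂ ⟨x, hTS x hx⟩ ⬝ᵥ W₂ ⟨x, hTS x hx⟩) := by
      intro x hx
      simpa only [down, dif_pos (hTS x hx), not_le] using (Finset.mem_filter.mp (hTsub hx)).2
    let e : Fin (n₁ + n₂ + m + 1) ≃ T := (T.equivFinOfCardEq hTcard).symm
    let emb : Fin (n₁ + n₂ + m + 1) → S := fun j => ⟨(e j : ℝ), hTS _ (e j).2⟩
    have hembinj : Function.Injective emb := fun j k h =>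
      e.injective (Subtype.ext (congrArg Subtype.val h : ((emb j : S) : ℝ) = ((emb k : S) : ℝ)))
    refine up_card_le_three (fun j => ((emb j : S) : ℝ) ^ a) (fun j => pow_pos (hx (emb j)) a) ?_
      (fun j => W₁ (emb j)) (fun j => W₂ (emb j)) (fun j => Q (emb j)) ?_ ?_
    · exact fun j k h => hembinj (hsinj _ _ h)
    · exact fun j k _ => hid (emb j) (emb k)
    · exact fun j => hTup (e j : ℝ) (e j).2
  omega

end MixedGauge

end Summit.ValiantsHypothesis.ValiantsHypothesis.Theorems.KPlusLogSqLaw
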